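import Mathlib
import HarnessLib
import Summits.NavierStokesRegularity.NavierStokesRegularity.Theorems.PoloidalWindowDoorLrcModEntireMorseLevelRays
import Summits.NavierStokesRegularity.NavierStokesRegularity.Theorems.PoloidalWindowDoorLrcModEntireMorseLevelRadial

/-!
# Route `PoloidalWindowDoor`, crux `PoloidalWindowRigidity` (K2, stmt-NavierStokesRegularity-19708) — NO X-POINT:
# a planar saddle of `ψ` cannot sit at a point where a function `f` frozen into `ψ` (`{ψ, f} = 0`) takes an
# isolated level value — analytic core of part B of stub Z1 `stub_threadZeroStructure` (line `centre_type`, ns-idea-8 g6)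

Cell ns-regularity-ideate, seat ns-poloidal-K2-p2 g11 (stub-worker on K2; `--supports` the crux item).  Pure calculus on
`ℝ³` along a frame `(e, n)` (in the application: `e` an ISOTROPIC direction of the horizontal Hessian of the Clebsch stream
function `ψ` at a thread, `n = Hessian·e`).  Hypotheses at `0`: `∂_eψ = ∂_nψ = 0`, `∂_e∂_eψ = 0`, `c := ∂_e∂_nψ > 0`, and the
bracket relation `∂_eψ·∂_nf − ∂_nψ·∂_ef ≡ 0` for a `C¹` function `f`.
* `exists_sector_slope` — on a thin sector `{ae + bn : 0 < a < r, |b| ≤ θa}`: `∂_nψ(ae + bn) ≥ (c/2)·a` (little-o at the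
  double zero); `exists_axis_flat` — `|ψ(ae) − ψ(0)| ≤ η a²` along the isotropic axis (mean value theorem);
* `exists_unique_sector_zero` — for small `a > 0`, `b ↦ ψ(ae + bn) − ψ(0)` has exactly one zero `|b| < θa` (IVT + monotonicity);
* `exists_levelPoint_near` — **THE NO-X-POINT LEMMA**: for every `δ > 0` there is `y = ae + bn ≠ 0`, `‖y‖ < δ`, with
  `f y = f 0` (the zero curve `b = γ(a)` is differentiable by the implicit function theorem — template: this lineage's
  `…MorseLevelRadial.differentiableAt_radialRoot` —, `f` is constant along it by the bracket, and it accumulates at `0`).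

WHAT THIS IS NOT: not a claim about Navier–Stokes regularity — elementary real analysis for one provable stub of an ideator
line of a door route (bears_on LADDER-NS N0, rung N0-LocalTubeDoorPoloidal).
-/

noncomputable section

-- the summit and its single sub-problem share the name (CONVENTIONS §1), as in every Theorems file
set_option linter.dupNamespace false

namespace Summit.NavierStokesRegularity.NavierStokesRegularity.Theorems.PoloidalWindowDoorPoloidalWindowRigidityThreadNoXPoint

open Set Function Filter Topology Metric
open Summit.NavierStokesRegularity.NavierStokesRegularity.Theorems.PoloidalWindowDoorLrcModEntireMorseLevelRays
open Summit.NavierStokesRegularity.NavierStokesRegularity.Theorems.PoloidalWindowDoorLrcModEntireMorseLevelRadial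

variable {ψ : EuclideanSpace ℝ (Fin 3) → ℝ} {e n : EuclideanSpace ℝ (Fin 3)}

/-! ### Taylor estimates at a double zero along a frame -/

/-- Little-o form of the differentiability at `0` of the first partial `y ↦ ∂_wψ(y)` of a `C²` function. -/
theorem exists_ball_fderiv_apply_sub_le (hψ : ContDiff ℝ 2 ψ) (w : EuclideanSpace ℝ (Fin 3)) {ε : ℝ}
    (hε : 0 < ε) :
    ∃ ρ > 0, ∀ y : EuclideanSpace ℝ (Fin 3), ‖y‖ < ρ →
      |fderiv ℝ ψ y w - fderiv ℝ ψ 0 w - fderiv ℝ (fun x => fderiv ℝ ψ x w) 0 y| ≤ ε * ‖y‖ := by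
  have hd : DifferentiableAt ℝ (fun x => fderiv ℝ ψ x w) 0 :=
    (contDiff_fderiv_apply_const hψ w).differentiable one_ne_zero 0
  have h := (Asymptotics.isLittleO_iff.1 hd.hasFDerivAt.isLittleO) hε
  simp only [sub_zero] at h
  obtain ⟨ρ, hρ, hball⟩ := Metric.eventually_nhds_iff.1 h
  exact ⟨ρ, hρ, fun y hy => by
    simpa [Real.norm_eq_abs] using hball (show dist y 0 < ρ by rwa [dist_zero_right])⟩

/-- **Transversal slope on a thin sector.**  If `∂_nψ(0) = 0` and `c = ∂_e∂_nψ(0) > 0`, then for suitable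
`θ, r > 0`: `∂_nψ(ae + bn) ≥ (c/2)·a` whenever `0 < a < r` and `|b| ≤ θa`. -/
theorem exists_sector_slope (hψ : ContDiff ℝ 2 ψ) (hn0 : fderiv ℝ ψ 0 n = 0)
    (hc : 0 < fderiv ℝ (fun x => fderiv ℝ ψ x n) 0 e) :
    ∃ θ > 0, ∃ r > 0, ∀ a b : ℝ, 0 < a → a < r → |b| ≤ θ * a →
      fderiv ℝ (fun x => fderiv ℝ ψ x n) 0 e / 2 * a ≤ fderiv ℝ ψ (a • e + b • n) n := by
  set c := fderiv ℝ (fun x => fderiv ℝ ψ x n) 0 e with hc_def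
  set d := fderiv ℝ (fun x => fderiv ℝ ψ x n) 0 n with hd_def
  set θ : ℝ := c / (4 * (|d| + 1)) with hθ_def
  have hθ : 0 < θ := by positivity
  set K : ℝ := ‖e‖ + θ * ‖n‖ with hK_def
  have hK : 0 ≤ K := by positivity
  set ε : ℝ := c / (4 * (K + 1)) with hε_def
  have hε : 0 < ε := by positivity
  obtain ⟨ρ, hρ, hball⟩ := exists_ball_fderiv_apply_sub_le hψ n hε
  refine ⟨θ, hθ, ρ / (K + 1), by positivity, fun a b ha har hb => ?_⟩
  have hy : ‖a • e + b • n‖ ≤ K * a := by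
    calc ‖a • e + b • n‖ ≤ ‖a • e‖ + ‖b • n‖ := norm_add_le _ _
      _ = a * ‖e‖ + |b| * ‖n‖ := by
          rw [norm_smul, norm_smul, Real.norm_eq_abs, Real.norm_eq_abs, abs_of_pos ha]
      _ ≤ a * ‖e‖ + θ * a * ‖n‖ := by gcongr
      _ = K * a := by rw [hK_def]; ring
  have hyρ : ‖a • e + b • n‖ < ρ := by
    have h1 : K * a ≤ (K + 1) * a := by nlinarith
    have h2 : (K + 1) * a < (K + 1) * (ρ / (K + 1)) := mul_lt_mul_of_pos_left har (by positivity)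
    have h3 : (K + 1) * (ρ / (K + 1)) = ρ := by field_simp
    linarith
  have hest := hball (a • e + b • n) hyρ
  have hL : fderiv ℝ (fun x => fderiv ℝ ψ x n) 0 (a • e + b • n) = a * c + b * d := by
    rw [map_add, map_smul, map_smul, smul_eq_mul, smul_eq_mul]
  rw [hn0, sub_zero, hL] at hest
  have h1 : a * c + b * d - ε * (K * a) ≤ fderiv ℝ ψ (a • e + b • n) n := by
    have h := (abs_le.1 hest).1
    nlinarith [hy, hε.le]
  have h2 : -(θ * a * |d|) ≤ b * d := by
    have h : |b * d| ≤ θ * a * |d| := by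
      rw [abs_mul]
      exact mul_le_mul_of_nonneg_right hb (abs_nonneg d)
    linarith [neg_abs_le (b * d)]
  have h3 : θ * |d| ≤ c / 4 := by
    rw [hθ_def, div_mul_eq_mul_div, div_le_div_iff₀ (by positivity) (by norm_num)]
    nlinarith [abs_nonneg d, hc]
  have h4 : ε * K ≤ c / 4 := by
    rw [hε_def, div_mul_eq_mul_div, div_le_div_iff₀ (by positivity) (by norm_num)]
    nlinarith [hK, hc]
  nlinarith [h1, h2, h3, h4, ha, mul_le_mul_of_nonneg_left h3 ha.le, mul_le_mul_of_nonneg_left h4 ha.le]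

/-- `d/dt ψ(t•e) = ∂_eψ(t•e)`. -/
theorem hasDerivAt_axis (hψ : Differentiable ℝ ψ) (e : EuclideanSpace ℝ (Fin 3)) (t : ℝ) :
    HasDerivAt (fun s : ℝ => ψ (s • e)) (fderiv ℝ ψ (t • e) e) t := by
  simpa only [zero_add] using hasDerivAt_ray hψ 0 e t

/-- **Flatness along the isotropic axis.**  If `∂_eψ(0) = 0` and `∂_e∂_eψ(0) = 0`, then for every `η > 0`:
`|ψ(ae) − ψ(0)| ≤ η a²` for `0 < a < r(η)`. -/
theorem exists_axis_flat (hψ : ContDiff ℝ 2 ψ) (he0 : fderiv ℝ ψ 0 e = 0)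
    (hee : fderiv ℝ (fun x => fderiv ℝ ψ x e) 0 e = 0) {η : ℝ} (hη : 0 < η) :
    ∃ r > 0, ∀ a : ℝ, 0 < a → a < r → |ψ (a • e) - ψ 0| ≤ η * a ^ 2 := by
  have hψd : Differentiable ℝ ψ := hψ.differentiable two_ne_zero
  set ε : ℝ := η / (‖e‖ + 1) with hε_def
  have hε : 0 < ε := by positivity
  obtain ⟨ρ, hρ, hball⟩ := exists_ball_fderiv_apply_sub_le hψ e hε
  refine ⟨ρ / (‖e‖ + 1), by positivity, fun a ha har => ?_⟩
  have hder : ∀ τ ∈ Icc 0 a, HasDerivWithinAt (fun s : ℝ => ψ (s • e)) (fderiv ℝ ψ (τ • e) e) (Icc 0 a) τ :=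
    fun τ _ => (hasDerivAt_axis hψd e τ).hasDerivWithinAt
  have hbound : ∀ τ ∈ Ico 0 a, ‖fderiv ℝ ψ (τ • e) e‖ ≤ η * a := by
    intro τ hτ
    have hτ0 : 0 ≤ τ := hτ.1
    have hτa : τ < a := hτ.2
    have hnorm : ‖τ • e‖ = τ * ‖e‖ := by rw [norm_smul, Real.norm_eq_abs, abs_of_nonneg hτ0]
    have hτy : ‖τ • e‖ < ρ := by
      rw [hnorm]
      have h1 : τ * ‖e‖ ≤ a * (‖e‖ + 1) := by nlinarith [norm_nonneg e]
      have h2 : a * (‖e‖ + 1) < ρ / (‖e‖ + 1) * (‖e‖ + 1) := mul_lt_mul_of_pos_right har (by positivity)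
      have h3 : ρ / (‖e‖ + 1) * (‖e‖ + 1) = ρ := by field_simp
      linarith
    have hest := hball (τ • e) hτy
    rw [he0, map_smul, hee, smul_zero, sub_zero, sub_zero, hnorm] at hest
    rw [Real.norm_eq_abs]
    have h4 : ε * (τ * ‖e‖) ≤ ε * (a * ‖e‖) := by gcongr
    have h5 : ε * (a * ‖e‖) ≤ η * a := by
      rw [hε_def]
      have : η / (‖e‖ + 1) * ‖e‖ ≤ η := by
        rw [div_mul_eq_mul_div, div_le_iff₀ (by positivity)]
        nlinarith [norm_nonneg e]
      nlinarith [this, ha.le]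
    linarith
  have h := norm_image_sub_le_of_norm_deriv_le_segment' hder hbound a (right_mem_Icc.2 ha.le)
  simp only [zero_smul, sub_zero, Real.norm_eq_abs] at h
  nlinarith [h]

/-! ### The zero curve of `ψ − ψ(0)` in the sector -/

/-- **Exactly one zero in the sector.**  Under the double-zero hypotheses with `c = ∂_e∂_nψ(0) > 0` there are
`θ, r > 0` such that for every `0 < a < r`: the slope `∂_nψ(ae + bn)` is positive for `|b| ≤ θa`, and
`b ↦ ψ(ae + bn) − ψ(0)` has exactly one zero with `|b| ≤ θa`, which satisfies `|b| < θa`. -/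
theorem exists_unique_sector_zero (hψ : ContDiff ℝ 2 ψ) (he0 : fderiv ℝ ψ 0 e = 0)
    (hn0 : fderiv ℝ ψ 0 n = 0) (hee : fderiv ℝ (fun x => fderiv ℝ ψ x e) 0 e = 0)
    (hc : 0 < fderiv ℝ (fun x => fderiv ℝ ψ x n) 0 e) :
    ∃ θ > 0, ∃ r > 0, ∀ a : ℝ, 0 < a → a < r →
      (∀ b : ℝ, |b| ≤ θ * a → 0 < fderiv ℝ ψ (a • e + b • n) n) ∧
      ∃ b : ℝ, |b| < θ * a ∧ ψ (a • e + b • n) = ψ 0 ∧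
        ∀ b' : ℝ, |b'| ≤ θ * a → ψ (a • e + b' • n) = ψ 0 → b' = b := by
  have hψd : Differentiable ℝ ψ := hψ.differentiable two_ne_zero
  set c := fderiv ℝ (fun x => fderiv ℝ ψ x n) 0 e with hc_def
  obtain ⟨θ, hθ, r₁, hr₁, hslope⟩ := exists_sector_slope hψ hn0 hc
  obtain ⟨r₂, hr₂, hflat⟩ := exists_axis_flat hψ he0 hee (η := c * θ / 4) (by positivity)
  refine ⟨θ, hθ, min r₁ r₂, lt_min hr₁ hr₂, fun a ha har => ?_⟩
  have har1 : a < r₁ := lt_of_lt_of_le har (min_le_left _ _)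
  have har2 : a < r₂ := lt_of_lt_of_le har (min_le_right _ _)
  have hθa : 0 < θ * a := mul_pos hθ ha
  set S : ℝ → ℝ := fun b => ψ (a • e + b • n) - ψ 0 with hS_def
  have hSd : ∀ b, HasDerivAt S (fderiv ℝ ψ (a • e + b • n) n) b := fun b =>
    (hasDerivAt_ray hψd (a • e) n b).sub_const (ψ 0)
  have hpos : ∀ b : ℝ, |b| ≤ θ * a → 0 < fderiv ℝ ψ (a • e + b • n) n := fun b hb =>
    lt_of_lt_of_le (by positivity) (hslope a b ha har1 hb)
  refine ⟨hpos, ?_⟩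
  -- monotonicity on `D = [-θa, θa]`
  have hD : Convex ℝ (Icc (-(θ * a)) (θ * a)) := convex_Icc _ _
  have hScont : ContinuousOn S (Icc (-(θ * a)) (θ * a)) := fun b _ =>
    (hSd b).continuousAt.continuousWithinAt
  have hSdiff : DifferentiableOn ℝ S (interior (Icc (-(θ * a)) (θ * a))) := fun b _ =>
    (hSd b).differentiableAt.differentiableWithinAt
  have hmem : ∀ b ∈ interior (Icc (-(θ * a)) (θ * a)), |b| ≤ θ * a := by
    intro b hb
    rw [interior_Icc] at hb
    exact abs_le.2 ⟨hb.1.le, hb.2.le⟩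
  have hge : ∀ b ∈ interior (Icc (-(θ * a)) (θ * a)), c / 2 * a ≤ deriv S b := fun b hb => by
    rw [(hSd b).deriv]; exact hslope a b ha har1 (hmem b hb)
  have hmono : StrictMonoOn S (Icc (-(θ * a)) (θ * a)) :=
    strictMonoOn_of_deriv_pos hD hScont fun b hb => by rw [(hSd b).deriv]; exact hpos b (hmem b hb)
  have hlin := hD.mul_sub_le_image_sub_of_le_deriv hScont hSdiff hge
  have h0mem : (0 : ℝ) ∈ Icc (-(θ * a)) (θ * a) := ⟨by linarith, by linarith⟩
  have htop : θ * a ∈ Icc (-(θ * a)) (θ * a) := ⟨by linarith, le_rfl⟩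
  have hbot : -(θ * a) ∈ Icc (-(θ * a)) (θ * a) := ⟨le_rfl, by linarith⟩
  have hS0 : |S 0| ≤ c * θ / 4 * a ^ 2 := by
    have h := hflat a ha har2
    simpa [hS_def] using h
  have hS0' := abs_le.1 hS0
  have hq : 0 < c * θ / 4 * a ^ 2 := by positivity
  have hup : 0 < S (θ * a) := by
    have h := hlin 0 h0mem (θ * a) htop hθa.le
    have h1 : c / 2 * a * (θ * a - 0) = 2 * (c * θ / 4 * a ^ 2) := by ring
    rw [h1] at h
    linarith [hS0'.1]
  have hdown : S (-(θ * a)) < 0 := by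
    have h := hlin (-(θ * a)) hbot 0 h0mem (by linarith)
    have h1 : c / 2 * a * (0 - -(θ * a)) = 2 * (c * θ / 4 * a ^ 2) := by ring
    rw [h1] at h
    linarith [hS0'.2]
  -- intermediate value
  obtain ⟨b, hbmem, hb0⟩ : ∃ b ∈ Icc (-(θ * a)) (θ * a), S b = 0 :=
    intermediate_value_Icc (by linarith) hScont ⟨hdown.le, hup.le⟩
  have hbIoo : |b| < θ * a := by
    have hb1 : b ≠ θ * a := fun h => by rw [h] at hb0; linarith
    have hb2 : b ≠ -(θ * a) := fun h => by rw [h] at hb0; linarith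
    exact abs_lt.2 ⟨lt_of_le_of_ne hbmem.1 (Ne.symm hb2), lt_of_le_of_ne hbmem.2 hb1⟩
  refine ⟨b, hbIoo, sub_eq_zero.1 hb0, fun b' hb' hSb' => ?_⟩
  have hSb : S b' = S b := by rw [hb0]; exact sub_eq_zero.2 hSb'
  exact hmono.injOn (abs_le.1 hb') hbmem hSb

/-! ### Derivatives along the frame lines and the bracket transfer -/

/-- `d/da ψ(a•e + b•n) = ∂_eψ(a•e + b•n)`. -/
theorem hasDerivAt_line_fst (hψ : Differentiable ℝ ψ) (e n : EuclideanSpace ℝ (Fin 3)) (a b : ℝ) :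
    HasDerivAt (fun s : ℝ => ψ (s • e + b • n)) (fderiv ℝ ψ (a • e + b • n) e) a := by
  simpa only [add_comm (b • n)] using hasDerivAt_ray hψ (b • n) e a

/-- `d/db ψ(a•e + b•n) = ∂_nψ(a•e + b•n)`. -/
theorem hasDerivAt_line_snd (hψ : Differentiable ℝ ψ) (e n : EuclideanSpace ℝ (Fin 3)) (a b : ℝ) :
    HasDerivAt (fun s : ℝ => ψ (a • e + s • n)) (fderiv ℝ ψ (a • e + b • n) n) b :=
  hasDerivAt_ray hψ (a • e) n b

/-- **Bracket transfer** (scalars): if `pₑ qₙ − pₙ qₑ = 0`, `pₙ ≠ 0` and `pₑ + γ' pₙ = 0`, then `qₑ + γ' qₙ = 0`. -/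
theorem bracket_transfer {pe pn qe qn γ' : ℝ} (hbr : pe * qn - pn * qe = 0) (hpn : pn ≠ 0)
    (hw : pe + γ' * pn = 0) : qe + γ' * qn = 0 := by
  have h : pn * (qe + γ' * qn) = qn * (pe + γ' * pn) - (pe * qn - pn * qe) := by ring
  rw [hw, hbr, mul_zero, sub_zero] at h
  exact (mul_eq_zero.1 h).resolve_left hpn

/-! ### The no-X-point lemma -/

/-- **NO X-POINT.**  Let `ψ ∈ C²(ℝ³)`, `f ∈ C¹(ℝ³)` with the bracket relation `∂_eψ·∂_nf − ∂_nψ·∂_ef ≡ 0` along a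
frame `(e, n)`, and suppose at `0`: `∂_eψ = ∂_nψ = 0`, `∂_e∂_eψ = 0`, `∂_e∂_nψ > 0` (a saddle-type double zero seen
along an isotropic direction).  Then for every `δ > 0` there is `y = a•e + b•n ≠ 0` with `‖y‖ < δ` and `f y = f 0`:
the zero curve of `ψ − ψ(0)` in the thin sector about `ℝ₊e` (unique zero `b = γ(a)`, differentiable in `a` by the
implicit function theorem) carries a constant value of `f` (bracket ⇒ `df` vanishes on its tangent) and accumulates
at `0`, where `f` is continuous. -/
theorem exists_levelPoint_near (hψ : ContDiff ℝ 2 ψ) {f : EuclideanSpace ℝ (Fin 3) → ℝ} (hf : ContDiff ℝ 1 f)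
    (hbr : ∀ y, fderiv ℝ ψ y e * fderiv ℝ f y n - fderiv ℝ ψ y n * fderiv ℝ f y e = 0)
    (he0 : fderiv ℝ ψ 0 e = 0) (hn0 : fderiv ℝ ψ 0 n = 0)
    (hee : fderiv ℝ (fun x => fderiv ℝ ψ x e) 0 e = 0)
    (hc : 0 < fderiv ℝ (fun x => fderiv ℝ ψ x n) 0 e) {δ : ℝ} (hδ : 0 < δ) :
    ∃ a b : ℝ, a • e + b • n ≠ 0 ∧ ‖a • e + b • n‖ < δ ∧ f (a • e + b • n) = f 0 := by
  have hψd : Differentiable ℝ ψ := hψ.differentiable two_ne_zero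
  have hψc1 : Continuous (fderiv ℝ ψ) := hψ.continuous_fderiv (by norm_num)
  have hfd : Differentiable ℝ f := hf.differentiable one_ne_zero
  have hfc : Continuous f := hf.continuous
  obtain ⟨θ, hθ, r, hr, hzero⟩ := exists_unique_sector_zero hψ he0 hn0 hee hc
  -- the root function `γ`
  have hγex : ∃ γ : ℝ → ℝ, ∀ a, 0 < a → a < r → |γ a| < θ * a ∧ ψ (a • e + γ a • n) = ψ 0 ∧
      ∀ b' : ℝ, |b'| ≤ θ * a → ψ (a • e + b' • n) = ψ 0 → b' = γ a := by
    classical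
    refine ⟨fun a => if h : 0 < a ∧ a < r then Classical.choose (hzero a h.1 h.2).2 else 0,
      fun a ha har => ?_⟩
    simp only [dif_pos (And.intro ha har)]
    exact Classical.choose_spec (hzero a ha har).2
  obtain ⟨γ, hγ⟩ := hγex
  have hslope : ∀ a, 0 < a → a < r → 0 < fderiv ℝ ψ (a • e + γ a • n) n := fun a ha har =>
    (hzero a ha har).1 (γ a) (hγ a ha har).1.le
  -- (1) `γ` is differentiable on `(0, r)` (implicit function theorem + uniqueness of the sector zero)
  have hγd : ∀ a₁, 0 < a₁ → a₁ < r → DifferentiableAt ℝ γ a₁ := by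
    intro a₁ ha₁ har₁
    set b₁ : ℝ := γ a₁ with hb₁
    set F : ℝ → ℝ → ℝ := fun a b => ψ (a • e + b • n) with hF
    set f₁ : ℝ → ℝ → ℝ →L[ℝ] ℝ := fun a b => (fderiv ℝ ψ (a • e + b • n) e) • (1 : ℝ →L[ℝ] ℝ) with hf₁
    set f₂ : ℝ → ℝ → ℝ →L[ℝ] ℝ := fun a b => (fderiv ℝ ψ (a • e + b • n) n) • (1 : ℝ →L[ℝ] ℝ) with hf₂
    have df₁ : ∀ᶠ v in 𝓝 (a₁, b₁), HasFDerivAt (F · v.2) (f₁ v.1 v.2) v.1 :=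
      Filter.Eventually.of_forall fun v => by
        rw [hasFDerivAt_iff_hasDerivAt, hf₁, smul_one_clm_apply_one]
        exact hasDerivAt_line_fst hψd e n v.1 v.2
    have df₂ : ∀ᶠ v in 𝓝 (a₁, b₁), HasFDerivAt (F v.1 ·) (f₂ v.1 v.2) v.2 :=
      Filter.Eventually.of_forall fun v => by
        rw [hasFDerivAt_iff_hasDerivAt, hf₂, smul_one_clm_apply_one]
        exact hasDerivAt_line_snd hψd e n v.1 v.2
    have hpath : Continuous fun q : ℝ × ℝ => q.1 • e + q.2 • n := by fun_prop
    have cf₁ : ContinuousAt ↿f₁ (a₁, b₁) := by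
      have hs : Continuous fun q : ℝ × ℝ => fderiv ℝ ψ (q.1 • e + q.2 • n) e :=
        (hψc1.comp hpath).clm_apply continuous_const
      have hcf : Continuous fun q : ℝ × ℝ => f₁ q.1 q.2 := by
        simp only [hf₁]
        exact hs.smul continuous_const
      exact hcf.continuousAt
    have cf₂ : ContinuousAt ↿f₂ (a₁, b₁) := by
      have hs : Continuous fun q : ℝ × ℝ => fderiv ℝ ψ (q.1 • e + q.2 • n) n :=
        (hψc1.comp hpath).clm_apply continuous_const
      have hcf : Continuous fun q : ℝ × ℝ => f₂ q.1 q.2 := by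
        simp only [hf₂]
        exact hs.smul continuous_const
      exact hcf.continuousAt
    have hd0 : fderiv ℝ ψ (a₁ • e + b₁ • n) n ≠ 0 := (hslope a₁ ha₁ har₁).ne'
    have hinv : (f₂ (a₁, b₁).1 (a₁, b₁).2).IsInvertible := by
      refine ⟨ContinuousLinearEquiv.unitsEquivAut ℝ (Units.mk0 _ hd0), ?_⟩
      ext
      simp [hf₂, mul_comm]
    set φ := implicitFunctionOfBivariate df₁ df₂ cf₁ cf₂ hinv with hφ
    have hφt : Tendsto φ (𝓝 a₁) (𝓝 b₁) := tendsto_implicitFunctionOfBivariate df₁ df₂ cf₁ cf₂ hinv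
    have hφF : ∀ᶠ a in 𝓝 a₁, F a (φ a) = F a₁ b₁ :=
      eventually_apply_implicitFunctionOfBivariate df₁ df₂ cf₁ cf₂ hinv
    have hφd : DifferentiableAt ℝ φ a₁ :=
      (hasStrictFDerivAt_implicitFunctionOfBivariate df₁ df₂ cf₁ cf₂ hinv).hasFDerivAt.differentiableAt
    -- near `a₁` the implicit function is the sector root
    have hsec : ∀ᶠ a in 𝓝 a₁, |φ a| < θ * a := by
      have ht : Tendsto (fun a => θ * a - |φ a|) (𝓝 a₁) (𝓝 (θ * a₁ - |b₁|)) :=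
        ((continuous_const.mul continuous_id).tendsto a₁).sub hφt.abs
      have hpos : 0 < θ * a₁ - |b₁| := by have := (hγ a₁ ha₁ har₁).1; rw [hb₁]; linarith
      filter_upwards [ht.eventually_const_lt hpos] with a ha
      linarith
    have hIoo : ∀ᶠ a in 𝓝 a₁, 0 < a ∧ a < r := by
      filter_upwards [Ioo_mem_nhds ha₁ har₁] with a ha using ha
    have heq : γ =ᶠ[𝓝 a₁] φ := by
      filter_upwards [hsec, hIoo, hφF] with a h1 h2 h3
      have h4 : ψ (a • e + φ a • n) = ψ 0 := by
        have h5 : F a₁ b₁ = ψ 0 := (hγ a₁ ha₁ har₁).2.1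
        rw [← h5]; exact h3
      exact ((hγ a h2.1 h2.2).2.2 (φ a) h1.le h4).symm
    exact hφd.congr_of_eventuallyEq heq
  -- (2) `f` is constant along the zero curve: zero derivative
  set P : ℝ → EuclideanSpace ℝ (Fin 3) := fun a => a • e + γ a • n with hP
  set h : ℝ → ℝ := fun a => f (P a) with hh
  have hPd : ∀ a₁, 0 < a₁ → a₁ < r → HasDerivAt P (e + deriv γ a₁ • n) a₁ := fun a₁ ha₁ har₁ => by
    have h1 : HasDerivAt (fun a : ℝ => a • e) ((1 : ℝ) • e) a₁ := (hasDerivAt_id a₁).smul_const e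
    have h3 := h1.add ((hγd a₁ ha₁ har₁).hasDerivAt.smul_const n)
    simp only [one_smul] at h3
    exact h3
  have hhd : ∀ a₁, 0 < a₁ → a₁ < r → HasDerivAt h 0 a₁ := by
    intro a₁ ha₁ har₁
    set w : EuclideanSpace ℝ (Fin 3) := e + deriv γ a₁ • n with hw
    -- chain rule for `f ∘ P` and `ψ ∘ P`
    have hfP : HasDerivAt h (fderiv ℝ f (P a₁) w) a₁ :=
      (hfd (P a₁)).hasFDerivAt.comp_hasDerivAt a₁ (hPd a₁ ha₁ har₁)
    have hψP : HasDerivAt (fun a => ψ (P a)) (fderiv ℝ ψ (P a₁) w) a₁ :=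
      (hψd (P a₁)).hasFDerivAt.comp_hasDerivAt a₁ (hPd a₁ ha₁ har₁)
    -- `ψ ∘ P` is constant near `a₁`
    have hψP0 : HasDerivAt (fun a => ψ (P a)) 0 a₁ := by
      have hconst : (fun a => ψ (P a)) =ᶠ[𝓝 a₁] fun _ => ψ 0 := by
        filter_upwards [Ioo_mem_nhds ha₁ har₁] with a ha
        exact (hγ a ha.1 ha.2).2.1
      exact (hasDerivAt_const a₁ (ψ 0)).congr_of_eventuallyEq hconst
    have hψw : fderiv ℝ ψ (P a₁) w = 0 := hψP.unique hψP0
    -- transfer to `f` by the bracket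
    have hfw : fderiv ℝ f (P a₁) w = 0 := by
      have hψw' : fderiv ℝ ψ (P a₁) e + deriv γ a₁ * fderiv ℝ ψ (P a₁) n = 0 := by
        rw [hw, map_add, map_smul, smul_eq_mul] at hψw; exact hψw
      have hfw' := bracket_transfer (hbr (P a₁)) (hslope a₁ ha₁ har₁).ne' hψw'
      rw [hw, map_add, map_smul, smul_eq_mul]; exact hfw'
    rw [hfw] at hfP
    exact hfP
  -- (3) `h` is constant on `(0, r)` and tends to `f 0` at `0⁺`, hence `h = f 0`
  have hconst : ∀ a₁, 0 < a₁ → a₁ < r → h a₁ = f 0 := by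
    intro a₁ ha₁ har₁
    have hK : ∀ a, 0 < a → a < r → ‖P a‖ ≤ (‖e‖ + θ * ‖n‖) * a := fun a ha har => by
      calc ‖P a‖ ≤ ‖a • e‖ + ‖γ a • n‖ := norm_add_le _ _
        _ = a * ‖e‖ + |γ a| * ‖n‖ := by
            rw [norm_smul, norm_smul, Real.norm_eq_abs, Real.norm_eq_abs, abs_of_pos ha]
        _ ≤ a * ‖e‖ + θ * a * ‖n‖ := by gcongr; exact (hγ a ha har).1.le
        _ = (‖e‖ + θ * ‖n‖) * a := by ring
    have hP0 : Tendsto P (𝓝[>] 0) (𝓝 0) := by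
      have ht : Tendsto (fun a : ℝ => (‖e‖ + θ * ‖n‖) * a) (𝓝 0) (𝓝 ((‖e‖ + θ * ‖n‖) * 0)) :=
        (continuous_const.mul continuous_id).tendsto 0
      rw [mul_zero] at ht
      have hev : ∀ᶠ a in 𝓝[>] (0 : ℝ), ‖P a‖ ≤ (‖e‖ + θ * ‖n‖) * a := by
        filter_upwards [Ioo_mem_nhdsGT hr] with a ha using hK a ha.1 ha.2
      exact squeeze_zero_norm' hev (tendsto_nhdsWithin_of_tendsto_nhds ht)
    have hlim : Tendsto h (𝓝[>] 0) (𝓝 (f 0)) := (hfc.tendsto 0).comp hP0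
    have hcst : Tendsto h (𝓝[>] 0) (𝓝 (h a₁)) := by
      refine tendsto_const_nhds.congr' ?_
      filter_upwards [Ioo_mem_nhdsGT hr] with a ha
      exact (isOpen_Ioo.is_const_of_deriv_eq_zero isPreconnected_Ioo
        (fun s hs => (hhd s hs.1 hs.2).differentiableAt.differentiableWithinAt)
        (fun s hs => (hhd s hs.1 hs.2).deriv) ⟨ha₁, har₁⟩ ha)
    exact tendsto_nhds_unique hcst hlim
  -- (4) the point
  set K : ℝ := ‖e‖ + θ * ‖n‖ with hK_def
  have hK0 : 0 ≤ K := by positivity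
  set a₀ : ℝ := min (r / 2) (δ / (2 * (K + 1))) with ha₀
  have ha₀pos : 0 < a₀ := lt_min (by positivity) (by positivity)
  have ha₀r : a₀ < r := lt_of_le_of_lt (min_le_left _ _) (by linarith)
  have ha₀δ : a₀ ≤ δ / (2 * (K + 1)) := min_le_right _ _
  refine ⟨a₀, γ a₀, ?_, ?_, hconst a₀ ha₀pos ha₀r⟩
  · intro h0
    have h1 := hslope a₀ ha₀pos ha₀r
    rw [h0, hn0] at h1
    exact lt_irrefl _ h1
  · calc ‖a₀ • e + γ a₀ • n‖ ≤ ‖a₀ • e‖ + ‖γ a₀ • n‖ := norm_add_le _ _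
      _ = a₀ * ‖e‖ + |γ a₀| * ‖n‖ := by
          rw [norm_smul, norm_smul, Real.norm_eq_abs, Real.norm_eq_abs, abs_of_pos ha₀pos]
      _ ≤ a₀ * ‖e‖ + θ * a₀ * ‖n‖ := by gcongr; exact (hγ a₀ ha₀pos ha₀r).1.le
      _ = K * a₀ := by rw [hK_def]; ring
      _ ≤ (K + 1) * (δ / (2 * (K + 1))) := by nlinarith
      _ = δ / 2 := by field_simp
      _ < δ := by linarith

end Summit.NavierStokesRegularity.NavierStokesRegularity.Theorems.PoloidalWindowDoorPoloidalWindowRigidityThreadNoXPoint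

end
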